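import Literature.MathematicalPhysics.QuantumFieldTheory.Balaban1983to89.B6Prop22LapMultiLevelTorus
import Literature.MathematicalPhysics.QuantumFieldTheory.Balaban1983to89.B6Prop22AdjMultiLevelTorus
import Literature.MathematicalPhysics.QuantumFieldTheory.Balaban1983to89.B6Prop22KLevelCensus

/-!
# `Balaban1983to89.B6Prop22KLevelTorusCensus` — [B6] Proposition 2.2 (2.67) IN ITS CENSUS TYPING ON THE GENUINE `k`-LEVEL
# FAMILY OF THE TORUS `T_η`: THE FIRST CONJUNCT of the verbatim `B6.Prop22Printed` — the four sup entries `|G′λ|, |∇G′λ|,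
# |G′∇*λ|, |ΔG′λ| ≤ O(1)[(L^jη)², L^jη, L^jη, 1]·e^{−½δ₀d(y,y′)}|λ|` — for EVERY nested family of domains (2.1)–(2.2) of the
# torus (print's carrier `Ω₁ = T_η`), every number of levels `k`, with constants depending on `d`, `L` only; and the
# non-vacuity of the family (file T8 of the torus carrier; no existing module is touched; no fact is minted)

FRAMING (verbatim cell line):
statement-level skeleton of published theorems with citation tags; proofs where landed; nothing here is a claim about the Yang–Mills mass gap

Source under audit (cell pub-balaban / lit-balaban): T. Bałaban, *Propagators and renormalization transformations for
lattice gauge theories. II*, Commun. Math. Phys. **96** (1984) 223–250 [`Balaban1984PropagatorsII`, "B6"], p. 224 [PDF 2]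
(2.1)–(2.4) («we admit the case when some domains Ω_j are equal to T_η»), p. 231 [PDF 9] (2.45)–(2.46), p. 234 [PDF 12]
Proposition 2.2 (2.67) (held text `paper:balaban1984-cmp96-propagators-rt-ii`, p0002/p0009/p0012).  Unit `lit-balaban-p21`
(Phase-2 proof seat p21 gen 15), HOME `run/shared/lean/pub/lit-balaban/`, B6 fold owner r03, referee ref-4.  Box sibling
(consumed BY NAME, untouched): `B6Prop22KLevelCensus` (r03 gen 12: the census typing on the box family `KIdx`).

## WHAT IS PRINTED (p. 234, verbatim up to notation)

«**Proposition 2.2.** If we have (2.1), (2.2) and M is sufficiently large, then the operator G′ = Δ′_a^{−1} (a = 1)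
satisfies the inequalities |(G′λ)(x)|, |(∇^η_xG′λ)(x)|, |(G′∇^{η*}λ)(x)|, ‖ζ∇^ηG′λ‖_α, ‖ζG′∇^{η*}λ‖_α, |(Δ^ηG′λ)(x)|
≤ O(1)[(L^jη)², L^jη, L^jη, (L^jη)^{1−α}(‖ζ‖_α + |ζ|), (L^jη)^{1−α}(‖ζ‖_α + |ζ|), 1]·e^{−½δ₀d(y,y′)}|λ|, x ∈ B^j(y) or
supp ζ ⊂ B^j(y), y ∈ Λ_j, supp λ ⊂ B^{j′}(y′), y′ ∈ Λ_{j′}. (2.67)»  (p. 224: «Ω₁ ⊃ Ω₂ ⊃ … ⊃ Ω_k, Ω_j ⊂ T_η,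
j = 1, 2, …, k» (2.1) and «we admit the case when some domains Ω_j are equal to T_η».)

## WHAT THIS FILE CERTIFIES (kernel-checked; setting of files T1–T7)

* §1 **THE INDEX FAMILY `KTIdx d ℓ`** of ALL nested families `D : TDomains d ℓ M_h k P R` of domains of the torus
  (`k ≥ 1` levels, `M_h ≥ 1`, `R ≥ 2L`, torus size `P_μ ≥ 4`), the member's genuine `k`-level operator
  `G′ = Δ′_a⁻¹ = gmlT` on `T_η` with the PRINTED weights `a_j = aPrinted ℓ 1 j` (`a = 1`);
* §2 **THE CENSUS GEOMETRY `geoT`** of a member (file T3's realised torus geometry `geomT D`: sites `𝔅`, scale = level,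
  `dist` = the torus distance (2.46), `η = 1`, `L`; `M := L·M_h`, `R := R`, the localisation vocabulary of (2.67)) and the
  (2.67) functionals `gp` of `G′` with the PERIODIC differences: `e 0 = sup_{x∈B(y)}|(G′λ)(x)|`,
  `e 1 = sup_{x∈B(y),μ}|(G′λ)(x + e_μ) − (G′λ)(x)|`, `e 2 = sup_{x∈B(y),μ}|(G′∂_μᵀλ)(x)|`, `e 3 = sup_{x∈B(y)}|((−Δ_T)G′λ)(x)|`;
* §3 **`prop22_supEntries_kLevelTorus`** — LITERALLY THE FIRST CONJUNCT of `B6.Prop22Printed (fun i : KTIdx d ℓ => i.geoT)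
  (fun i => i.gp)`: `∃ M₁ δ₀ C > 0` (functions of `d`, `L`) `∀ i, Hyp21_22 → M₁ ≤ M → ∀ m λ y y′, suppIn λ y′ →
  gp.e m λ y ≤ C·pref4 (len y) m·e^{−½δ₀·dist y y′}·|λ|` — from files T4 (`prop22_first_multiLevelTorus`), T6
  (`prop22_second_multiLevelTorus`), T7 (`prop22_third_multiLevelTorus`), T5 (`prop22_sixth_multiLevelTorus`) BY NAME, with
  `δ₀ := min`, `C := sum`, `M₁ := max` of the four packages' constants and `3L`, the printed weights' windows
  `a_j ∈ [1 − L^{−2}, 1]` (`B6Prop22KLevelCensus.KIdx.aPrinted_windows`);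
* §4 **NON-VACUITY**: for every `k ≥ 2` and threshold `M₁` a member with `M ≥ M₁` whose torus geometry has blocks at BOTH
  top levels (`kLevelTorus_nonvacuous`, the member `twoTopT`: one big `k`-block of the torus at level `k`, the rest at level
  `k − 1`; (2.1) by construction, the torus (2.2) void), print's admitted member `Ω₁ = … = Ω_k = T_η` for every `k ≥ 1`
  (`kLevelTorus_top`), and (§5) for every `k ≥ 3` a member with THREE levels present and the TORUS (2.2) ACTIVE
  (`kLevelTorus_nonvacuous3`, the member `threeTopT`: a two-sided collar of big `(k−1)`-blocks around the top block, torus of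
  six big `k`-blocks per direction).

## HONEST SCOPE

(1) Lattice units as in files T1–T7 (`G′` here is `η^{−2}G′` of print; the dictionary to print's units is exact for the four
sup entries, as in the box census).  (2) The Hölder conjunct of `B6.Prop22Printed` (entries 4, 5) is NOT certified on the
torus family here (the box lineage's Hölder files 10–13 are not transported).  (3) Levels `1 … k`, `Ω₁ = T_η`, no level
`0`/`a₀ = +∞`, `m² = 0`, `P_μ ≥ 4`, asymmetric partition, Neumann two-level cube inverses — as in T1–T7.  (4) The
(2.61)-constant is the `L`-dependent one of `B6Ineq261LevelGap`.  (5) Non-vacuity exhibits two levels ((2.2) void) and three levels with the torus (2.2) active; deeper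
nested shapes are not constructed here (the theorem quantifies over all of them).  Nothing is inferred from the
manuscript: every step is kernel-checked.
-/

noncomputable section

open scoped BigOperators
open Finset Matrix

namespace Literature.MathematicalPhysics.QuantumFieldTheory.Balaban1983to89.B6Prop22KLevelTorusCensus

open Literature.MathematicalPhysics.QuantumFieldTheory.Balaban1983to89.B4ContourShift (supNorm abs_le_supNorm supNorm_nonneg)
open Literature.MathematicalPhysics.QuantumFieldTheory.Balaban1983to89.B4Reflection242 (boxDom mem_boxDom blk)
open Literature.MathematicalPhysics.QuantumFieldTheory.Balaban1983to89.B4TorusKernel.MultiPeriod (torusSupNorm circAbs)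
open Literature.MathematicalPhysics.QuantumFieldTheory.Balaban1983to89.B6MultiLevelBoxOperator (N0 bigSide Domains aPrinted
  aPrinted_window aPrinted_succ one_le_bigSide)
open Literature.MathematicalPhysics.QuantumFieldTheory.Balaban1983to89.B6Geom246MultiLevelBox (bset blkOf geom bond
  exists_blkOf_eq lev_eq_of_blkOf_eq)
open Literature.MathematicalPhysics.QuantumFieldTheory.Balaban1983to89.B6Ineq243TwoLevelBox (aNext)
open Literature.MathematicalPhysics.QuantumFieldTheory.Balaban1983to89.B6RandomWalk (HasMajorant BlockSupp)
open Literature.MathematicalPhysics.QuantumFieldTheory.Balaban1983to89.B6 (Geometry GpFamily Prop22Printed pref4)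
open Literature.MathematicalPhysics.QuantumFieldTheory.Balaban1983to89.B6MultiLevelTorusOperator
open Literature.MathematicalPhysics.QuantumFieldTheory.Balaban1983to89.B6Geom246MultiLevelTorus
open Literature.MathematicalPhysics.QuantumFieldTheory.Balaban1983to89.B6Prop22MultiLevelTorus (prop22_first_multiLevelTorus)
open Literature.MathematicalPhysics.QuantumFieldTheory.Balaban1983to89.B6Prop22DerivMultiLevelTorus (dT dT_mulVec
  prop22_second_multiLevelTorus)
open Literature.MathematicalPhysics.QuantumFieldTheory.Balaban1983to89.B6Prop22AdjMultiLevelTorus (prop22_third_multiLevelTorus)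
open Literature.MathematicalPhysics.QuantumFieldTheory.Balaban1983to89.B6Prop22LapMultiLevelTorus (prop22_sixth_multiLevelTorus)
open Literature.MathematicalPhysics.QuantumFieldTheory.Balaban1983to89.B6Prop22KLevelCensus (KIdx.aPrinted_windows)

variable {d : ℕ}

/-! ## §1 The index family of all nested families (2.1)–(2.2) of the torus and the genuine `k`-level operator -/

/-- **INDEX OF THE `k`-LEVEL TORUS FAMILY** (`d`, `L = ℓ + 1` fixed): `k ≥ 1` levels, big-block parameter `M_h ≥ 1`
(`M = L·M_h`), the integer `R ≥ 2L` of (2.2), torus size `P_μ ≥ 4` (torus `T_η = Π_μ[0, L^{k+1}M_hP_μ)` periodic), and the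
nested family of domains of the torus as its level function `D` ((2.1) = `D.bigBlocks`, (2.2) with the torus distance =
`D.sepT`). [cite: Balaban1984PropagatorsII, (2.1)–(2.4) p.224 («Ω₁ ⊃ Ω₂ ⊃ … ⊃ Ω_k, Ω_j ⊂ T_η»)] -/
structure KTIdx (d ℓ : ℕ) where
  k : ℕ
  Mh : ℕ
  R : ℕ
  P : Fin (d + 1) → ℕ
  D : TDomains d ℓ Mh k P R
  hk : 1 ≤ k
  hMh : 1 ≤ Mh
  hR : 2 * (ℓ + 1) ≤ R
  hP4 : ∀ μ, 4 ≤ P μ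

namespace KTIdx

variable {ℓ : ℕ} (i : KTIdx d ℓ)

/-- `P_μ ≥ 1`. [cite: Balaban1984PropagatorsII, (2.1) p.224, dictionary] -/
theorem hP : ∀ μ, 1 ≤ i.P μ := fun μ => le_trans (by norm_num) (i.hP4 μ)

/-- the side vector of the fundamental box of the member's torus. [cite: Balaban1984PropagatorsII, (2.1) p.224, dictionary] -/
abbrev NB : Fin (d + 1) → ℕ := N0 ℓ i.Mh i.k i.P

/-- the fundamental box `Π_μ[0, N₀_μ)` of the torus `T_η = Ω₁`. [cite: Balaban1984PropagatorsII, (2.1) p.224 («Ω₁»), dictionary] -/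
abbrev XB : Finset (Fin (d + 1) → ℤ) := boxDom i.NB

/-- the origin as a site of the torus (the torus is non-empty). [cite: Balaban1984PropagatorsII, (2.1) p.224, dictionary] -/
def origin : ↥(i.XB) :=
  ⟨0, by
    rw [mem_boxDom]; intro μ
    have : 1 ≤ i.NB μ := one_le_N0 i.hMh i.hP μ
    simp only [Pi.zero_apply]; exact ⟨le_rfl, by exact_mod_cast this⟩⟩

/-- the torus is non-empty (needed for the suprema `sup_x`). [cite: Balaban1984PropagatorsII, (2.1) p.224, dictionary] -/
instance : Nonempty ↥(i.XB) := ⟨i.origin⟩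

/-- **THE GENUINE `k`-LEVEL OPERATOR OF THE MEMBER ON THE TORUS** `G′ = Δ′_a⁻¹ = gmlT` with the PRINTED weights
`a_j = aPrinted ℓ 1 j` (`a₁ = a = 1`, recursion (2.14)), `m² = 0`. [cite: Balaban1984PropagatorsII, p.225 («The operator G′ = Δ′_a^{−1}»), (2.13)–(2.14) p.225, Prop. 2.2 p.234 («(a = 1)»)] -/
def G : Matrix ↥(i.XB) ↥(i.XB) ℝ := gmlT i.NB ℓ i.k i.D.lev (aPrinted ℓ 1)

/-! ## §2 The census geometry of the member and the (2.67) functionals of `G′` (periodic differences) -/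

/-- the sup norm `|λ| = sup_x |λ(x)|`. [cite: Balaban1984PropagatorsII, Prop. 2.2 (2.67) p.234 («|λ|»)] -/
def supF (f : ↥(i.XB) → ℝ) : ℝ := ⨆ x : ↥(i.XB), |f x|

open Classical in
/-- the lattice Hölder seminorm `‖f‖_α = sup_{x ≠ x′}|f(x′) − f(x)|/|x′ − x|_T^α` with the torus sup-distance (lattice units).
[cite: Balaban1984PropagatorsII, Prop. 2.2 (2.67) p.234 («‖ζ‖_α»); Balaban1984PropagatorsI, (1.109) p.35] -/
def hq (α : ℝ) (f : ↥(i.XB) → ℝ) : ℝ :=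
  ⨆ p : ↥(i.XB) × ↥(i.XB), if p.1 ≠ p.2 then |f p.2 - f p.1| / (torusSupNorm i.NB (p.2.1 - p.1.1)) ^ α else 0

open Classical in
/-- **THE CENSUS GEOMETRY OF THE MEMBER**: file T3's realised torus geometry `geomT D` (sites `𝔅`, `scale` = level,
`dist` = (2.46) on the torus, `η = 1`, `L`) with `M := L·M_h`, `R := R`, the localisation vocabulary of (2.67) on real
functions on the torus (`supp λ ⊂ B(y′)` via `blkOf`, `|λ| = supF`, `‖·‖_α = hq`); `Hyp21_22 = True` — (2.1)–(2.2) are the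
fields of `D`. [cite: Balaban1984PropagatorsII, (2.1)–(2.4) p.224, (2.45)–(2.46) p.231, Prop. 2.2 (2.67) p.234] -/
def geoT : Geometry :=
  { geomT i.D with
    R := i.R
    M := ((ℓ : ℝ) + 1) * i.Mh
    Loc := ↥(i.XB) → ℝ
    suppIn := fun f s => ∀ x, f x ≠ 0 → blkOf i.D.toDomains x = s
    supNorm := i.supF
    l2Norm := fun f => Real.sqrt (∑ x, f x ^ 2)
    holder := i.hq
    Cut := ↥(i.XB) → ℝ
    cutIn := fun ζ s => ∀ x, ζ x ≠ 0 → blkOf i.D.toDomains x = s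
    cutH := fun α ζ => i.hq α ζ + i.supF ζ
    cutSup := i.supF }

/-- the sites of the census geometry are the blocks `𝔅` of the torus. [cite: Balaban1984PropagatorsII, (2.45) p.231, dictionary] -/
@[simp] theorem geoT_Site : i.geoT.Site = ↥(bset i.D.toDomains) := rfl
/-- `dist` = the realised torus distance (2.46). [cite: Balaban1984PropagatorsII, (2.46) p.231, dictionary] -/
theorem geoT_dist (s t : ↥(bset i.D.toDomains)) : i.geoT.dist s t = (((bondT i.D).dist s t : ℕ) : ℝ) := rfl
/-- `scale` = the level of the block. [cite: Balaban1984PropagatorsII, (2.45) p.231, dictionary] -/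
theorem geoT_scale (s : ↥(bset i.D.toDomains)) : i.geoT.scale s = s.1.1 := rfl
/-- `supp λ ⊂ B(y′)` unfolded. [cite: Balaban1984PropagatorsII, Prop. 2.2 p.234 («for λ with supp λ ⊂ B^{j′}(y′)»), dictionary] -/
theorem geoT_suppIn (f : ↥(i.XB) → ℝ) (s : ↥(bset i.D.toDomains)) :
    i.geoT.suppIn f s ↔ ∀ x, f x ≠ 0 → blkOf i.D.toDomains x = s := Iff.rfl
/-- `L^jη = L^j` in lattice units. [cite: Balaban1984PropagatorsII, (2.67) p.234 (the factors L^jη), dictionary] -/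
theorem geoT_len (s : ↥(bset i.D.toDomains)) : i.geoT.len s = ((ℓ : ℝ) + 1) ^ s.1.1 * 1 := rfl

open Classical in
/-- entry (2.67)₁: `sup_{x ∈ B^j(y)} |(G′λ)(x)|`. [cite: Balaban1984PropagatorsII, Prop. 2.2 (2.67) p.234] -/
def e0 (f : ↥(i.XB) → ℝ) (s : ↥(bset i.D.toDomains)) : ℝ :=
  ⨆ x : ↥(i.XB), if blkOf i.D.toDomains x = s then |(i.G *ᵥ f) x| else 0

open Classical in
/-- entry (2.67)₂: `sup_{x ∈ B^j(y), μ} |(G′λ)(x + e_μ) − (G′λ)(x)|` (periodic forward difference, lattice units).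
[cite: Balaban1984PropagatorsII, Prop. 2.2 (2.67) p.234] -/
def e1 (f : ↥(i.XB) → ℝ) (s : ↥(bset i.D.toDomains)) : ℝ :=
  ⨆ p : ↥(i.XB) × Fin (d + 1), if blkOf i.D.toDomains p.1 = s then
    |(i.G *ᵥ f) (tshift i.NB (unitVec p.2) p.1) - (i.G *ᵥ f) p.1| else 0

open Classical in
/-- entry (2.67)₃: `sup_{x ∈ B^j(y), μ} |(G′∂_μᵀλ)(x)|` (periodic difference transposed). [cite: Balaban1984PropagatorsII, Prop. 2.2 (2.67) p.234] -/
def e2 (f : ↥(i.XB) → ℝ) (s : ↥(bset i.D.toDomains)) : ℝ :=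
  ⨆ p : ↥(i.XB) × Fin (d + 1), if blkOf i.D.toDomains p.1 = s then |((i.G * (dT i.NB p.2)ᵀ) *ᵥ f) p.1| else 0

open Classical in
/-- entry (2.67)₆: `sup_{x ∈ B^j(y)} |((−Δ_T)G′λ)(x)|` (the periodic Laplacian of file T1). [cite: Balaban1984PropagatorsII, Prop. 2.2 (2.67) p.234] -/
def e3 (f : ↥(i.XB) → ℝ) (s : ↥(bset i.D.toDomains)) : ℝ :=
  ⨆ x : ↥(i.XB), if blkOf i.D.toDomains x = s then |((perLapT i.NB * i.G) *ᵥ f) x| else 0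

/-- the Hölder entries (2.67)₄,₅ with the periodic differences (recorded for the census record; not bounded in this file).
[cite: Balaban1984PropagatorsII, Prop. 2.2 (2.67) p.234] -/
def hH (f : ↥(i.XB) → ℝ) (α : ℝ) (ζ : ↥(i.XB) → ℝ) : ℝ :=
  ⨆ p : Fin (d + 1) × Bool, if p.2 then
      i.hq α (fun x => ζ x * ((i.G *ᵥ f) (tshift i.NB (unitVec p.1) x) - (i.G *ᵥ f) x))
    else i.hq α (fun x => ζ x * ((i.G * (dT i.NB p.1)ᵀ) *ᵥ f) x)

/-- **THE (2.67) FUNCTIONALS OF `G′` ON THE MEMBER** in the census record `B6.GpFamily`. [cite: Balaban1984PropagatorsII, Prop. 2.2 (2.67) p.234] -/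
def gp : GpFamily i.geoT where
  e := ![i.e0, i.e1, i.e2, i.e3]
  h1 := i.hH

/-- a block-supported `λ` in the sense of the census is `BlockSupp` with the bound `|λ|` in the majorant language.
[cite: Balaban1984PropagatorsII, Prop. 2.2 p.234 («supp λ ⊂ B^{j′}(y′)»), (2.51) p.232, dictionary] -/
theorem blockSupp_of_suppIn (f : ↥(i.XB) → ℝ) (s : ↥(bset i.D.toDomains))
    (h : ∀ x, f x ≠ 0 → blkOf i.D.toDomains x = s) :
    BlockSupp (g := geomT i.D) (blkOf i.D.toDomains) f s (i.supF f) where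
  nonneg := le_ciSup_of_le (Set.finite_range fun x : ↥(i.XB) => |f x|).bddAbove i.origin (abs_nonneg _)
  bound := fun x _ => le_ciSup (Set.finite_range fun x : ↥(i.XB) => |f x|).bddAbove x
  off := fun x hx => by by_contra hf; exact hx (h x hf)

/-- the forward difference of entry 2: `((∂_μG′)λ)(x) = (G′λ)(x + e_μ) − (G′λ)(x)` on the torus. [cite: Balaban1984PropagatorsII, (2.67) p.234 (the entry ∇G′λ), dictionary] -/
theorem dT_G_mulVec (μ : Fin (d + 1)) (f : ↥(i.XB) → ℝ) (x : ↥(i.XB)) :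
    ((dT i.NB μ * i.G) *ᵥ f) x = (i.G *ᵥ f) (tshift i.NB (unitVec μ) x) - (i.G *ᵥ f) x := by
  rw [← Matrix.mulVec_mulVec, dT_mulVec]

end KTIdx

/-! ## §3 The four sup entries of (2.67) in census form on the whole `k`-level torus family -/

open KTIdx in
/-- **PROPOSITION 2.2 (2.67), THE FOUR SUP ENTRIES, IN THE CENSUS TYPING ON THE GENUINE `k`-LEVEL TORUS FAMILY** —
LITERALLY THE FIRST CONJUNCT of the verbatim `B6.Prop22Printed (fun i : KTIdx d ℓ => i.geoT) (fun i => i.gp)` over the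
index family of ALL nested families (2.1)–(2.2) of domains of the torus `T_η` (every number of levels `k ≥ 1`, every torus
size `P_μ ≥ 4`, every `R ≥ 2L`): there are `M₁, δ₀, C > 0` (depending on `d`, `L` only) such that for every member with
`M = L·M_h ≥ M₁` («M sufficiently large»), every entry `m ∈ {0,1,2,3}` (= (2.67)₁,₂,₃,₆), every `λ` with
`supp λ ⊂ B^{j′}(y′)` and every block `y`: `e_m(λ, y) ≤ C·[(L^jη)², L^jη, L^jη, 1]_m·e^{−½δ₀·d_T(y,y′)}·|λ|`, `d_T` = the
REALISED torus distance (2.46), `G′ = Δ′_a⁻¹` the genuine `k`-level operator of the torus with the printed weights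
(`a = 1`).  From files T4/T6/T7/T5 (`prop22_first/second/third/sixth_multiLevelTorus`) BY NAME, with `δ₀ := min`,
`C := sum`, `M₁ := max`. [cite: Balaban1984PropagatorsII, Prop. 2.2 (2.67) p.234 (entries 1–3 and 6); (2.46) p.231; p.224 (Ω₁ = T_η admitted)] -/
theorem prop22_supEntries_kLevelTorus (d ℓ : ℕ) (hℓ : 1 ≤ ℓ) :
    ∃ M₁ δ₀ C : ℝ, 0 < M₁ ∧ 0 < δ₀ ∧ 0 < C ∧
      ∀ i : KTIdx d ℓ, i.geoT.Hyp21_22 → M₁ ≤ i.geoT.M →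
        ∀ (m : Fin 4) (lam : i.geoT.Loc) (y y' : i.geoT.Site), i.geoT.suppIn lam y' →
          i.gp.e m lam y ≤ C * pref4 (i.geoT.len y) m * Real.exp (-(δ₀ / 2 * i.geoT.dist y y')) * i.geoT.supNorm lam := by
  classical
  set amin : ℝ := 1 - ((((ℓ : ℝ) + 1)) ^ 2)⁻¹ with hamin_def
  have hL2 : (1 : ℝ) < (((ℓ : ℝ) + 1)) ^ 2 := by
    have : (2 : ℝ) ≤ (ℓ : ℝ) + 1 := by
      have : (1 : ℝ) ≤ ℓ := by exact_mod_cast hℓ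
      linarith
    nlinarith
  have hamin : 0 < amin := by
    rw [hamin_def, sub_pos]
    exact inv_lt_one_of_one_lt₀ hL2
  obtain ⟨hwin, hrec⟩ := KIdx.aPrinted_windows hℓ
  obtain ⟨δ₁, C₁, M₁', N₁, hδ₁, hC₁, hM₁', hN₁, hA1⟩ := prop22_first_multiLevelTorus d ℓ hℓ amin 1 1 1 hamin one_pos
  obtain ⟨δ₂, C₂, M₂', N₂, hδ₂, hC₂, hM₂', hN₂, hA2⟩ := prop22_second_multiLevelTorus d ℓ hℓ amin 1 1 1 hamin one_pos
  obtain ⟨δ₃, C₃, M₃', N₃, hδ₃, hC₃, hM₃', hN₃, hA3⟩ := prop22_third_multiLevelTorus d ℓ hℓ amin 1 1 1 hamin one_pos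
  obtain ⟨δ₆, C₆, M₆', N₆, hδ₆, hC₆, hM₆', hN₆, hA6⟩ := prop22_sixth_multiLevelTorus d ℓ hℓ amin 1 1 1 hamin one_pos
  -- common constants
  set δ₀ : ℝ := min (min δ₁ δ₂) (min δ₃ δ₆) with hδ₀
  set C : ℝ := C₁ + C₂ + C₃ + C₆ with hC
  set Nm : ℕ := max (max N₁ N₂) (max N₃ N₆) with hNm
  set M₁ : ℝ := max (max (max (max M₁' M₂') (max M₃' M₆')) ((Nm : ℝ) + 1)) (3 * ((ℓ : ℝ) + 1)) with hM₁
  have hδ₀pos : 0 < δ₀ := lt_min (lt_min hδ₁ hδ₂) (lt_min hδ₃ hδ₆)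
  refine ⟨M₁, δ₀, C, lt_of_lt_of_le hM₁'
    (le_trans (le_trans (le_trans (le_max_left _ _) (le_max_left _ _)) (le_max_left _ _)) (le_max_left _ _)),
    hδ₀pos, by positivity, ?_⟩
  intro i _ hM m lam y y' hsupp
  change ↥(i.XB) → ℝ at lam
  change M₁ ≤ ((ℓ : ℝ) + 1) * i.Mh at hM
  -- «M sufficiently large» for all four packages
  have hMa : max (max M₁' M₂') (max M₃' M₆') ≤ ((ℓ : ℝ) + 1) * i.Mh :=
    le_trans (le_trans (le_max_left _ _) (le_max_left _ _)) hM
  have hL : (0 : ℝ) < (ℓ : ℝ) + 1 := by positivity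
  have hMh3 : 3 ≤ i.Mh := by
    have h3 : 3 * ((ℓ : ℝ) + 1) ≤ ((ℓ : ℝ) + 1) * i.Mh := le_trans (le_max_right _ _) hM
    have : (3 : ℝ) ≤ i.Mh := by nlinarith
    exact_mod_cast this
  have hRM : ∀ N : ℕ, N ≤ Nm → N + 1 ≤ i.R * ((ℓ + 1) * i.Mh) := by
    intro N hN
    have h1 : ((Nm : ℝ) + 1) ≤ ((ℓ : ℝ) + 1) * i.Mh :=
      le_trans (le_trans (le_max_right _ _) (le_max_left _ _)) hM
    have h2 : Nm + 1 ≤ (ℓ + 1) * i.Mh := by exact_mod_cast h1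
    have hR1 : 1 ≤ i.R := le_trans (by omega) i.hR
    calc N + 1 ≤ 1 * ((ℓ + 1) * i.Mh) := by rw [one_mul]; omega
      _ ≤ i.R * ((ℓ + 1) * i.Mh) := Nat.mul_le_mul_right _ hR1
  have hN1m : N₁ ≤ Nm := le_trans (le_max_left _ _) (le_max_left _ _)
  have hN2m : N₂ ≤ Nm := le_trans (le_max_right _ _) (le_max_left _ _)
  have hN3m : N₃ ≤ Nm := le_trans (le_max_left _ _) (le_max_right _ _)
  have hN6m : N₆ ≤ Nm := le_trans (le_max_right _ _) (le_max_right _ _)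
  have hM1a : M₁' ≤ ((ℓ : ℝ) + 1) * i.Mh := le_trans (le_trans (le_max_left _ _) (le_max_left _ _)) hMa
  have hM2a : M₂' ≤ ((ℓ : ℝ) + 1) * i.Mh := le_trans (le_trans (le_max_right _ _) (le_max_left _ _)) hMa
  have hM3a : M₃' ≤ ((ℓ : ℝ) + 1) * i.Mh := le_trans (le_trans (le_max_left _ _) (le_max_right _ _)) hMa
  have hM6a : M₆' ≤ ((ℓ : ℝ) + 1) * i.Mh := le_trans (le_trans (le_max_right _ _) (le_max_right _ _)) hMa
  rw [geoT_suppIn] at hsupp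
  have hBS := i.blockSupp_of_suppIn lam y' hsupp
  have hB0 : 0 ≤ i.supF lam := hBS.nonneg
  -- the common exponential and the comparison of the packages' bounds with the common one
  set E : ℝ := Real.exp (-(δ₀ / 2 * i.geoT.dist y y')) with hE
  have hdist0 : 0 ≤ i.geoT.dist y y' := by rw [geoT_dist]; exact Nat.cast_nonneg _
  have hEmono : ∀ δ : ℝ, δ₀ ≤ δ → Real.exp (-(δ / 2 * (geomT i.D).dist y y')) ≤ E := by
    intro δ hδ
    rw [hE]; apply Real.exp_le_exp.2
    have : (geomT i.D).dist y y' = i.geoT.dist y y' := rfl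
    rw [this]; nlinarith
  have hlen : i.geoT.len y = ((ℓ : ℝ) + 1) ^ y.1.1 := by rw [geoT_len, mul_one]
  have hpref0 : ∀ m : Fin 4, 0 ≤ pref4 (i.geoT.len y) m := by
    intro m; rw [hlen]; fin_cases m <;> simp [pref4] <;> positivity
  have htarget0 : 0 ≤ C * pref4 (i.geoT.len y) m * E * i.supF lam := by
    have := hpref0 m; positivity
  change i.gp.e m lam y ≤ C * pref4 (i.geoT.len y) m * E * i.supF lam
  have step : ∀ (Cm δm v : ℝ), 0 ≤ Cm → Cm ≤ C → δ₀ ≤ δm →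
      |v| ≤ Cm * pref4 (i.geoT.len y) m * Real.exp (-(δm / 2 * (geomT i.D).dist y y')) * i.supF lam →
      |v| ≤ C * pref4 (i.geoT.len y) m * E * i.supF lam := by
    intro Cm δm v hCm hCmC hδm hv
    refine hv.trans ?_
    have h1 : Cm * pref4 (i.geoT.len y) m * Real.exp (-(δm / 2 * (geomT i.D).dist y y')) * i.supF lam
        ≤ Cm * pref4 (i.geoT.len y) m * E * i.supF lam :=
      mul_le_mul_of_nonneg_right (mul_le_mul_of_nonneg_left (hEmono δm hδm)
        (mul_nonneg hCm (hpref0 m))) hB0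
    have h2 : Cm * pref4 (i.geoT.len y) m * E * i.supF lam ≤ C * pref4 (i.geoT.len y) m * E * i.supF lam := by
      have : 0 ≤ pref4 (i.geoT.len y) m * E * i.supF lam := by have := hpref0 m; positivity
      nlinarith
    exact h1.trans h2
  have hC1le : C₁ ≤ C := by rw [hC]; linarith
  have hC2le : C₂ ≤ C := by rw [hC]; linarith
  have hC3le : C₃ ≤ C := by rw [hC]; linarith
  have hC6le : C₆ ≤ C := by rw [hC]; linarith
  have hδ01 : δ₀ ≤ δ₁ := le_trans (min_le_left _ _) (min_le_left _ _)
  have hδ02 : δ₀ ≤ δ₂ := le_trans (min_le_left _ _) (min_le_right _ _)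
  have hδ03 : δ₀ ≤ δ₃ := le_trans (min_le_right _ _) (min_le_left _ _)
  have hδ06 : δ₀ ≤ δ₆ := le_trans (min_le_right _ _) (min_le_right _ _)
  fin_cases m
  · -- entry 1: |(G′λ)(x)|, prefactor (L^j)²
    have hmaj := hA1 i.k i.Mh i.R hMh3 hM1a i.hR (hRM N₁ hN1m) i.P i.hP i.hP4 i.D (aPrinted ℓ 1) (fun _ => 1) hwin
      (fun j _ => ⟨le_rfl, le_rfl⟩) hrec
    have hp : pref4 (i.geoT.len y) 0 = (i.geoT.len y) ^ 2 := rfl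
    show i.e0 lam y ≤ C * pref4 (i.geoT.len y) 0 * E * i.supF lam
    unfold KTIdx.e0
    refine ciSup_le fun x => ?_
    split_ifs with hx
    · have h := hmaj y' lam (i.supF lam) hBS x
      rw [Matrix.toLin'_apply, hx] at h
      refine step C₁ δ₁ _ hC₁.le hC1le hδ01 (h.trans (le_of_eq ?_))
      show _ = C₁ * pref4 (i.geoT.len y) 0 * _ * _
      beta_reduce
      rw [hp, hlen]
      ring
    · exact htarget0
  · -- entry 2: |(G′λ)(x + e_μ) − (G′λ)(x)|, prefactor L^j
    have hmaj := hA2 i.k i.Mh i.R hMh3 hM2a i.hR (hRM N₂ hN2m) i.P i.hP i.hP4 i.D (aPrinted ℓ 1) (fun _ => 1) hwin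
      (fun j _ => ⟨le_rfl, le_rfl⟩) hrec
    have hp : pref4 (i.geoT.len y) 1 = i.geoT.len y := rfl
    show i.e1 lam y ≤ C * pref4 (i.geoT.len y) 1 * E * i.supF lam
    unfold KTIdx.e1
    refine ciSup_le fun p => ?_
    split_ifs with hx
    · have h := hmaj p.2 y' lam (i.supF lam) hBS p.1
      rw [Matrix.toLin'_apply, hx] at h
      have h' : |(i.G *ᵥ lam) (tshift i.NB (unitVec p.2) p.1) - (i.G *ᵥ lam) p.1|
          ≤ C₂ * ((ℓ : ℝ) + 1) ^ y.1.1 * Real.exp (-(δ₂ / 2 * (geomT i.D).dist y y')) * i.supF lam := by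
        rw [← dT_G_mulVec]; exact h
      refine step C₂ δ₂ _ hC₂.le hC2le hδ02 (h'.trans (le_of_eq ?_))
      show _ = C₂ * pref4 (i.geoT.len y) 1 * _ * _
      rw [hp, hlen]
    · exact htarget0
  · -- entry 3: |(G′∂_μᵀλ)(x)|, prefactor L^j
    have hmaj := hA3 i.k i.Mh i.R hMh3 hM3a i.hR (hRM N₃ hN3m) i.P i.hP i.hP4 i.D (aPrinted ℓ 1) (fun _ => 1) hwin
      (fun j _ => ⟨le_rfl, le_rfl⟩) hrec
    have hp : pref4 (i.geoT.len y) 2 = i.geoT.len y := rfl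
    show i.e2 lam y ≤ C * pref4 (i.geoT.len y) 2 * E * i.supF lam
    unfold KTIdx.e2
    refine ciSup_le fun p => ?_
    split_ifs with hx
    · have h := hmaj p.2 y' lam (i.supF lam) hBS p.1
      rw [Matrix.toLin'_apply, hx] at h
      refine step C₃ δ₃ _ hC₃.le hC3le hδ03 (h.trans (le_of_eq ?_))
      show _ = C₃ * pref4 (i.geoT.len y) 2 * _ * _
      rw [hp, hlen]
    · exact htarget0
  · -- entry 6: |((−Δ_T)G′λ)(x)|, prefactor 1
    have hmaj := hA6 i.k i.Mh i.R hMh3 hM6a i.hR (hRM N₆ hN6m) i.P i.hP i.hP4 i.D (aPrinted ℓ 1) (fun _ => 1) hwin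
      (fun j _ => ⟨le_rfl, le_rfl⟩) hrec
    have hp : pref4 (i.geoT.len y) 3 = 1 := rfl
    show i.e3 lam y ≤ C * pref4 (i.geoT.len y) 3 * E * i.supF lam
    unfold KTIdx.e3
    refine ciSup_le fun x => ?_
    split_ifs with hx
    · have h := hmaj y' lam (i.supF lam) hBS x
      rw [Matrix.toLin'_apply, hx] at h
      refine step C₆ δ₆ _ hC₆.le hC6le hδ06 (h.trans (le_of_eq ?_))
      show _ = C₆ * pref4 (i.geoT.len y) 3 * _ * _
      rw [hp, mul_one]
    · exact htarget0

/-! ## §4 Non-vacuity: torus members with the two top levels present beyond every threshold «M sufficiently large» -/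

namespace KTIdx

/-- the level function of the member with ONE big block of the top level `k` (label `0`), level `k − 1` elsewhere.
[cite: Balaban1984PropagatorsII, (2.1) p.224] -/
def topLev (ℓ k Mh : ℕ) (x : Fin (d + 1) → ℤ) : ℕ := if blk (bigSide ℓ Mh k) x = 0 then k else k - 1

/-- `topLev ∈ {k − 1, k}`. [cite: Balaban1984PropagatorsII, (2.1) p.224, dictionary] -/
theorem topLev_eq_or (ℓ k Mh : ℕ) (x : Fin (d + 1) → ℤ) :
    topLev (d := d) ℓ k Mh x = k ∨ topLev (d := d) ℓ k Mh x = k - 1 := by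
  unfold topLev; split_ifs <;> simp

/-- **THE TWO-TOP-LEVEL MEMBER OF THE TORUS** of four big `k`-blocks per direction: `Ω₁ = … = Ω_{k−1} = T_η`, `Ω_k` = the big
`k`-block at the origin; (2.1) by construction, the torus (2.2) void. [cite: Balaban1984PropagatorsII, (2.1)–(2.2) p.224] -/
def twoTopT (d ℓ k Mh : ℕ) (hk : 2 ≤ k) (hMh : 1 ≤ Mh) : KTIdx d ℓ where
  k := k
  Mh := Mh
  R := 2 * (ℓ + 1)
  P := fun _ => 4
  D :=
    { lev := topLev ℓ k Mh
      one_le_lev := fun x => by rcases topLev_eq_or (d := d) ℓ k Mh x with h | h <;> omega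
      lev_le := fun x => by rcases topLev_eq_or (d := d) ℓ k Mh x with h | h <;> omega
      bigBlocks := by
        intro j hj x _ x' _ hb
        by_cases hjk : j ≤ k - 1
        · constructor <;> intro _
          · rcases topLev_eq_or (d := d) ℓ k Mh x' with h | h <;> omega
          · rcases topLev_eq_or (d := d) ℓ k Mh x with h | h <;> omega
        by_cases hje : j = k
        · subst hje
          have key : ∀ y : Fin (d + 1) → ℤ, j ≤ topLev (d := d) ℓ j Mh y ↔ blk (bigSide ℓ Mh j) y = 0 := by
            intro y; unfold topLev; split_ifs with h
            · simp [h]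
            · simp only [h, iff_false, not_le]; omega
          rw [key, key, hb]
        · constructor <;> intro h
          · rcases topLev_eq_or (d := d) ℓ k Mh x with e | e <;> omega
          · rcases topLev_eq_or (d := d) ℓ k Mh x' with e | e <;> omega
      sepT := by
        intro j x _ x' _ h1 h2
        rcases topLev_eq_or (d := d) ℓ k Mh x with e | e <;> rcases topLev_eq_or (d := d) ℓ k Mh x' with e' | e' <;>
          simp only [e, e'] at h1 h2 <;> omega }
  hk := by omega
  hMh := hMh
  hR := le_rfl
  hP4 := fun _ => le_rfl

/-- the origin has level `k` in `twoTopT`. [cite: Balaban1984PropagatorsII, (2.1) p.224] -/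
theorem twoTopT_lev_zero (d ℓ k Mh : ℕ) (hk : 2 ≤ k) (hMh : 1 ≤ Mh) :
    (twoTopT d ℓ k Mh hk hMh).D.lev 0 = k := by
  show topLev (d := d) ℓ k Mh 0 = k
  unfold topLev
  have hb : blk (bigSide ℓ Mh k) (0 : Fin (d + 1) → ℤ) = 0 := by funext μ; simp [blk]
  rw [if_pos hb]

/-- the corner of the neighbouring big block (first direction) is a site of the torus … [cite: Balaban1984PropagatorsII, (2.1) p.224] -/
theorem twoTopT_corner_mem (d ℓ k Mh : ℕ) (hk : 2 ≤ k) (hMh : 1 ≤ Mh) :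
    (fun μ : Fin (d + 1) => if μ = 0 then ((bigSide ℓ Mh k : ℕ) : ℤ) else 0) ∈ (twoTopT d ℓ k Mh hk hMh).XB := by
  rw [mem_boxDom]; intro μ
  have hside : (twoTopT d ℓ k Mh hk hMh).NB μ = bigSide ℓ Mh k * 4 := by
    show N0 ℓ Mh k (fun _ => 4) μ = bigSide ℓ Mh k * 4
    rw [N0_eq_bigSide_mul]
  rw [hside]
  have hpos : 1 ≤ bigSide ℓ Mh k := one_le_bigSide hMh _
  split_ifs
  · constructor
    · positivity
    · push_cast; linarith [(show (1 : ℤ) ≤ bigSide ℓ Mh k by exact_mod_cast hpos)]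
  · constructor
    · exact le_rfl
    · push_cast; positivity

/-- … and has level `k − 1`. [cite: Balaban1984PropagatorsII, (2.1) p.224] -/
theorem twoTopT_lev_corner (d ℓ k Mh : ℕ) (hk : 2 ≤ k) (hMh : 1 ≤ Mh) :
    (twoTopT d ℓ k Mh hk hMh).D.lev (fun μ : Fin (d + 1) => if μ = 0 then ((bigSide ℓ Mh k : ℕ) : ℤ) else 0) = k - 1 := by
  show topLev (d := d) ℓ k Mh _ = k - 1
  unfold topLev
  have hpos : 1 ≤ bigSide ℓ Mh k := one_le_bigSide hMh _
  have hb : blk (bigSide ℓ Mh k) (fun μ : Fin (d + 1) => if μ = 0 then ((bigSide ℓ Mh k : ℕ) : ℤ) else 0)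
      = fun μ => if μ = 0 then 1 else 0 := by
    funext μ; simp only [blk]
    have hne : ((bigSide ℓ Mh k : ℕ) : ℤ) ≠ 0 := by exact_mod_cast (by omega : bigSide ℓ Mh k ≠ 0)
    split_ifs
    · exact Int.ediv_self hne
    · simp
  have hnot : (fun μ : Fin (d + 1) => if μ = 0 then (1 : ℤ) else 0) ≠ 0 := by
    intro h
    have := congrFun h 0; simp at this
  rw [hb, if_neg hnot]

/-- **PRINT'S ADMITTED MEMBER `Ω₁ = … = Ω_k = T_η`** («we admit the case when some domains Ω_j are equal to T_η»): every
site of the torus at level `k`, for every `k ≥ 1`, `M_h ≥ 1`, `P_μ ≥ 4`. [cite: Balaban1984PropagatorsII, (2.1) p.224] -/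
def topT (d ℓ k Mh : ℕ) (P : Fin (d + 1) → ℕ) (hk : 1 ≤ k) (hMh : 1 ≤ Mh) (hP4 : ∀ μ, 4 ≤ P μ) : KTIdx d ℓ where
  k := k
  Mh := Mh
  R := 2 * (ℓ + 1)
  P := P
  D := TDomains.top d ℓ Mh k P (2 * (ℓ + 1)) hk
  hk := hk
  hMh := hMh
  hR := le_rfl
  hP4 := hP4

end KTIdx

open KTIdx in
/-- **NON-VACUITY OF THE `k`-LEVEL TORUS FAMILY**: for every `k ≥ 2` and every threshold `M₁` there is a member with
`M = L·M_h ≥ M₁` whose torus geometry has blocks at BOTH top levels `k` and `k − 1` (so `prop22_supEntries_kLevelTorus`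
speaks about multiscale geometries of the torus beyond every threshold; the torus (2.2) is void for this witness).
[cite: Balaban1984PropagatorsII, (2.1)–(2.2) p.224, Prop. 2.2 p.234 («M is sufficiently large»)] -/
theorem kLevelTorus_nonvacuous (d ℓ k : ℕ) (hk : 2 ≤ k) (M₁ : ℝ) :
    ∃ i : KTIdx d ℓ, i.k = k ∧ M₁ ≤ i.geoT.M ∧ i.geoT.Hyp21_22 ∧
      (∃ s : i.geoT.Site, i.geoT.scale s = k) ∧ (∃ s : i.geoT.Site, i.geoT.scale s = k - 1) := by
  set Mh : ℕ := max 1 ⌈M₁⌉₊ with hMh_def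
  have hMh : 1 ≤ Mh := le_max_left _ _
  refine ⟨twoTopT d ℓ k Mh hk hMh, rfl, ?_, trivial, ?_, ?_⟩
  · change M₁ ≤ ((ℓ : ℝ) + 1) * ((twoTopT d ℓ k Mh hk hMh).Mh : ℝ)
    have h1 : M₁ ≤ (Mh : ℝ) := le_trans (Nat.le_ceil M₁) (by exact_mod_cast le_max_right 1 ⌈M₁⌉₊)
    have h2 : (Mh : ℝ) ≤ ((ℓ : ℝ) + 1) * Mh := by
      have : (0 : ℝ) ≤ Mh := Nat.cast_nonneg Mh
      nlinarith [(Nat.cast_nonneg ℓ : (0 : ℝ) ≤ ℓ)]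
    exact h1.trans (by exact_mod_cast h2)
  · refine ⟨blkOf (twoTopT d ℓ k Mh hk hMh).D.toDomains (twoTopT d ℓ k Mh hk hMh).origin, ?_⟩
    rw [geoT_scale, ← lev_eq_of_blkOf_eq (D := (twoTopT d ℓ k Mh hk hMh).D.toDomains) rfl]
    exact twoTopT_lev_zero d ℓ k Mh hk hMh
  · refine ⟨blkOf (twoTopT d ℓ k Mh hk hMh).D.toDomains ⟨_, twoTopT_corner_mem d ℓ k Mh hk hMh⟩, ?_⟩
    rw [geoT_scale, ← lev_eq_of_blkOf_eq (D := (twoTopT d ℓ k Mh hk hMh).D.toDomains) rfl]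
    exact twoTopT_lev_corner d ℓ k Mh hk hMh

open KTIdx in
/-- **PRINT'S ADMITTED MEMBER IS IN THE FAMILY** beyond every threshold: for every `k ≥ 1` and `M₁` a member with all of `T_η`
at level `k` and `M ≥ M₁`. [cite: Balaban1984PropagatorsII, (2.1) p.224 («we admit the case when some domains Ω_j are equal to T_η»)] -/
theorem kLevelTorus_top (d ℓ k : ℕ) (hk : 1 ≤ k) (M₁ : ℝ) :
    ∃ i : KTIdx d ℓ, i.k = k ∧ M₁ ≤ i.geoT.M ∧ i.geoT.Hyp21_22 ∧ ∀ s : i.geoT.Site, i.geoT.scale s = k := by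
  set Mh : ℕ := max 1 ⌈M₁⌉₊ with hMh_def
  have hMh : 1 ≤ Mh := le_max_left _ _
  refine ⟨topT d ℓ k Mh (fun _ => 4) hk hMh (fun _ => le_rfl), rfl, ?_, trivial, ?_⟩
  · change M₁ ≤ ((ℓ : ℝ) + 1) * ((topT d ℓ k Mh (fun _ => 4) hk hMh (fun _ => le_rfl)).Mh : ℝ)
    have h1 : M₁ ≤ (Mh : ℝ) := le_trans (Nat.le_ceil M₁) (by exact_mod_cast le_max_right 1 ⌈M₁⌉₊)
    have h2 : (Mh : ℝ) ≤ ((ℓ : ℝ) + 1) * Mh := by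
      have : (0 : ℝ) ≤ Mh := Nat.cast_nonneg Mh
      nlinarith [(Nat.cast_nonneg ℓ : (0 : ℝ) ≤ ℓ)]
    exact h1.trans (by exact_mod_cast h2)
  · intro s
    obtain ⟨x, hx⟩ := exists_blkOf_eq (topT d ℓ k Mh (fun _ => 4) hk hMh (fun _ => le_rfl)).D.toDomains s
    rw [geoT_scale, ← lev_eq_of_blkOf_eq (D := (topT d ℓ k Mh (fun _ => 4) hk hMh (fun _ => le_rfl)).D.toDomains) hx]
    rfl

/-! ## §5 Non-vacuity with the torus separation (2.2) ACTIVE: members with THREE levels present -/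

namespace KTIdx

/-- the level function of the three-top-level TORUS member (`k = k′ + 3`, six big `k`-blocks per direction): level `k` on the
big `k`-block at the origin, level `k − 1` on the TWO-SIDED collar of big `(k−1)`-blocks around it (labels `< 3L` or `≥ 4L`
mod `6L` in every direction), level `k − 2` elsewhere — so that `Ω_{k−1}^c` and `Ω_k` are more than `2L` big `(k−1)`-blocks
apart ACROSS THE TORUS, as (2.2) with `R = 2L` and the torus distance demands. [cite: Balaban1984PropagatorsII, (2.1)–(2.2) p.224] -/
def threeLevT (ℓ k' Mh : ℕ) (x : Fin (d + 1) → ℤ) : ℕ :=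
  if blk (bigSide ℓ Mh (k' + 3)) x = 0 then k' + 3
  else if ∀ ν, blk (bigSide ℓ Mh (k' + 2)) x ν < 3 * ((ℓ : ℤ) + 1) ∨ 4 * ((ℓ : ℤ) + 1) ≤ blk (bigSide ℓ Mh (k' + 2)) x ν
    then k' + 2 else k' + 1

/-- `threeLevT ∈ {k′+1, k′+2, k′+3}`. [cite: Balaban1984PropagatorsII, (2.1) p.224, dictionary] -/
theorem threeLevT_cases (ℓ k' Mh : ℕ) (x : Fin (d + 1) → ℤ) :
    threeLevT (d := d) ℓ k' Mh x = k' + 1 ∨ threeLevT (d := d) ℓ k' Mh x = k' + 2 ∨ threeLevT (d := d) ℓ k' Mh x = k' + 3 := by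
  unfold threeLevT; split_ifs <;> simp

/-- `Ω_k = {k ≤ lev}` is the big top block at the origin. [cite: Balaban1984PropagatorsII, (2.1) p.224, dictionary] -/
theorem three_le_threeLevT_iff (ℓ k' Mh : ℕ) (x : Fin (d + 1) → ℤ) :
    k' + 3 ≤ threeLevT (d := d) ℓ k' Mh x ↔ blk (bigSide ℓ Mh (k' + 3)) x = 0 := by
  unfold threeLevT; split_ifs with h1 h2
  · simp [h1]
  · simp only [h1, iff_false, not_le]; omega
  · simp only [h1, iff_false, not_le]; omega

/-- `Ω_{k−1} = {k − 1 ≤ lev}` is the two-sided collar of big `(k−1)`-blocks (it contains `Ω_k`). [cite: Balaban1984PropagatorsII, (2.1) p.224, dictionary] -/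
theorem two_le_threeLevT_iff (ℓ k' Mh : ℕ) (x : Fin (d + 1) → ℤ) :
    k' + 2 ≤ threeLevT (d := d) ℓ k' Mh x ↔
      (blk (bigSide ℓ Mh (k' + 3)) x = 0 ∨
        ∀ ν, blk (bigSide ℓ Mh (k' + 2)) x ν < 3 * ((ℓ : ℤ) + 1) ∨ 4 * ((ℓ : ℤ) + 1) ≤ blk (bigSide ℓ Mh (k' + 2)) x ν) := by
  unfold threeLevT; split_ifs with h1 h2
  · simp [h1]
  · simp [h1, h2]
  · simp only [h1, h2, or_self, iff_false, not_le]; omega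

/-- a coordinate of the torus sup-distance bounds it from below. [cite: Balaban1983RegularityDecay, p.572, dictionary] -/
theorem circAbs_le_torusSupNorm (N : Fin (d + 1) → ℕ) (v : Fin (d + 1) → ℤ) (ν : Fin (d + 1)) :
    ((circAbs (N ν) (v ν) : ℤ) : ℝ) ≤ torusSupNorm N v :=
  Finset.le_sup' (fun i => ((circAbs (N i) (v i) : ℤ) : ℝ)) (Finset.mem_univ ν)

/-- **THE THREE-TOP-LEVEL MEMBER OF THE TORUS** (`k = k′ + 3`, `R = 2L`, torus of `6L` big `(k−1)`-blocks per direction):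
(2.1) by the nesting of big blocks, **the torus (2.2) ACTIVE**: a site below level `k − 1` and a site of level `k` are more than
`R·M·L^{k−1} = 2L·bigSide(k−1)` apart IN THE TORUS DISTANCE (the collar is two-sided). [cite: Balaban1984PropagatorsII, (2.1)–(2.2) p.224] -/
def threeTopT (d ℓ k' Mh : ℕ) (hMh : 1 ≤ Mh) : KTIdx d ℓ where
  k := k' + 3
  Mh := Mh
  R := 2 * (ℓ + 1)
  P := fun _ => 6
  D :=
    { lev := threeLevT ℓ k' Mh
      one_le_lev := fun x => by rcases threeLevT_cases (d := d) ℓ k' Mh x with h | h | h <;> omega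
      lev_le := fun x => by rcases threeLevT_cases (d := d) ℓ k' Mh x with h | h | h <;> omega
      bigBlocks := by
        intro j hj x _ x' _ hb
        by_cases hj1 : j ≤ k' + 1
        · constructor <;> intro _
          · rcases threeLevT_cases (d := d) ℓ k' Mh x' with h | h | h <;> omega
          · rcases threeLevT_cases (d := d) ℓ k' Mh x with h | h | h <;> omega
        by_cases hj2 : j = k' + 2
        · subst hj2
          rw [two_le_threeLevT_iff, two_le_threeLevT_iff, B6Prop22KLevelCensus.KIdx.blk_top_eq,
            B6Prop22KLevelCensus.KIdx.blk_top_eq, hb]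
        by_cases hj3 : j = k' + 3
        · subst hj3
          rw [three_le_threeLevT_iff, three_le_threeLevT_iff, hb]
        · constructor <;> intro h
          · rcases threeLevT_cases (d := d) ℓ k' Mh x with e | e | e <;> omega
          · rcases threeLevT_cases (d := d) ℓ k' Mh x' with e | e | e <;> omega
      sepT := by
        intro j x hx x' hx' h1 h2
        have hx3 := threeLevT_cases (d := d) ℓ k' Mh x
        have hx'3 := threeLevT_cases (d := d) ℓ k' Mh x'
        have hj : j = k' + 2 := by rcases hx3 with e | e | e <;> rcases hx'3 with e' | e' | e' <;> omega
        subst hj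
        -- `x′ ∈ Ω_k`: all its coordinates lie in `[0, bigSide k)`
        have htop : blk (bigSide ℓ Mh (k' + 3)) x' = 0 :=
          (three_le_threeLevT_iff (d := d) ℓ k' Mh x').1 (by omega)
        -- `x ∉ Ω_{k−1}`: some big `(k−1)`-label coordinate lies in `[3L, 4L)`
        have hlow : ¬ (k' + 2 ≤ threeLevT (d := d) ℓ k' Mh x) := by omega
        rw [two_le_threeLevT_iff, not_or, not_forall] at hlow
        obtain ⟨-, ⟨ν, hν⟩⟩ := hlow
        rw [not_or, not_lt, not_le] at hν
        obtain ⟨hν1, hν2⟩ := hν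
        set b : ℕ := bigSide ℓ Mh (k' + 2) with hb_def
        have hb1 : 1 ≤ b := one_le_bigSide hMh _
        have hbpos : (0 : ℤ) < b := by exact_mod_cast hb1
        have hB : ((bigSide ℓ Mh (k' + 3) : ℕ) : ℤ) = ((ℓ : ℤ) + 1) * b := by
          rw [B6MultiLevelBoxOperator.bigSide_succ]; push_cast; ring
        have hN : ((N0 ℓ Mh (k' + 3) (fun _ => 6) ν : ℕ) : ℤ) = 6 * (((ℓ : ℤ) + 1) * b) := by
          rw [N0_eq_bigSide_mul]; push_cast; rw [hB]; ring
        -- coordinate bounds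
        have hxν : 3 * ((ℓ : ℤ) + 1) * b ≤ x ν := by
          have h := hν1
          simp only [blk] at h
          rwa [Int.le_ediv_iff_mul_le hbpos] at h
        have hxν' : x ν < 4 * ((ℓ : ℤ) + 1) * b := by
          have h := hν2
          simp only [blk] at h
          exact Int.lt_mul_of_ediv_lt hbpos h
        have hx'ν0 : 0 ≤ x' ν := ((mem_boxDom.1 hx') ν).1
        have hx'ν : x' ν < ((ℓ : ℤ) + 1) * b := by
          have h0 : blk (bigSide ℓ Mh (k' + 3)) x' ν = 0 := by rw [htop]; rfl
          simp only [blk] at h0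
          have hBpos : (0 : ℤ) < ((bigSide ℓ Mh (k' + 3) : ℕ) : ℤ) := by rw [hB]; positivity
          have := Int.lt_mul_of_ediv_lt hBpos (show x' ν / ((bigSide ℓ Mh (k' + 3) : ℕ) : ℤ) < 1 by rw [h0]; norm_num)
          rw [one_mul, hB] at this
          exact this
        -- the coordinate `ν` of `x − x′` lies in `(2L·b, 4L·b)` inside the period `6L·b`
        have hz1 : 2 * ((ℓ : ℤ) + 1) * b < (x - x') ν := by rw [Pi.sub_apply]; nlinarith
        have hz2 : (x - x') ν < 4 * ((ℓ : ℤ) + 1) * b := by rw [Pi.sub_apply]; nlinarith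
        have hz0 : 0 ≤ (x - x') ν := by nlinarith
        have hmod : (x - x') ν % ((N0 ℓ Mh (k' + 3) (fun _ => 6) ν : ℕ) : ℤ) = (x - x') ν :=
          Int.emod_eq_of_lt hz0 (by rw [hN]; nlinarith)
        have hcirc : 2 * ((ℓ : ℤ) + 1) * b < circAbs (N0 ℓ Mh (k' + 3) (fun _ => 6) ν) ((x - x') ν) := by
          unfold circAbs
          rw [hmod, hN, lt_min_iff]
          constructor
          · exact hz1
          · nlinarith
        have h1 : (((2 * (ℓ + 1) * b : ℕ) : ℤ) : ℝ) < ((circAbs (N0 ℓ Mh (k' + 3) (fun _ => 6) ν) ((x - x') ν) : ℤ) : ℝ) := by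
          have : ((2 * (ℓ + 1) * b : ℕ) : ℤ) < circAbs (N0 ℓ Mh (k' + 3) (fun _ => 6) ν) ((x - x') ν) := by
            push_cast; linarith
          exact_mod_cast this
        have h2 := circAbs_le_torusSupNorm (N0 ℓ Mh (k' + 3) (fun _ => 6)) (x - x') ν
        have e : ((2 * (ℓ + 1) * bigSide ℓ Mh (k' + 2) : ℕ) : ℝ) = (((2 * (ℓ + 1) * b : ℕ) : ℤ) : ℝ) := by
          rw [hb_def]; push_cast; ring
        rw [e]
        linarith }
  hk := by omega
  hMh := hMh
  hR := le_rfl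
  hP4 := fun _ => by norm_num

/-- the side of the fundamental box of `threeTopT` is `6` big `k`-blocks. [cite: Balaban1984PropagatorsII, (2.1) p.224, dictionary] -/
theorem threeTopT_NB (d ℓ k' Mh : ℕ) (hMh : 1 ≤ Mh) (μ : Fin (d + 1)) :
    (threeTopT d ℓ k' Mh hMh).NB μ = bigSide ℓ Mh (k' + 3) * 6 := by
  show N0 ℓ Mh (k' + 3) (fun _ => 6) μ = _
  rw [N0_eq_bigSide_mul]

/-- the origin has level `k`. [cite: Balaban1984PropagatorsII, (2.1) p.224] -/
theorem threeTopT_lev_zero (d ℓ k' Mh : ℕ) (hMh : 1 ≤ Mh) : (threeTopT d ℓ k' Mh hMh).D.lev 0 = k' + 3 := by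
  show threeLevT (d := d) ℓ k' Mh 0 = k' + 3
  unfold threeLevT
  have hb : blk (bigSide ℓ Mh (k' + 3)) (0 : Fin (d + 1) → ℤ) = 0 := by funext μ; simp [blk]
  rw [if_pos hb]

/-- the site `bigSide(k)·e₀` (corner of the next big `k`-block) lies in the torus … [cite: Balaban1984PropagatorsII, (2.1) p.224] -/
theorem threeTopT_x1_mem (d ℓ k' Mh : ℕ) (hMh : 1 ≤ Mh) :
    (fun μ : Fin (d + 1) => if μ = 0 then ((bigSide ℓ Mh (k' + 3) : ℕ) : ℤ) else 0) ∈ (threeTopT d ℓ k' Mh hMh).XB := by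
  rw [mem_boxDom]; intro μ
  rw [threeTopT_NB]
  have hpos : 1 ≤ bigSide ℓ Mh (k' + 3) := one_le_bigSide hMh _
  split_ifs
  · refine ⟨by positivity, ?_⟩
    have : bigSide ℓ Mh (k' + 3) * 1 < bigSide ℓ Mh (k' + 3) * 6 :=
      Nat.mul_lt_mul_of_pos_left (by omega) (by omega)
    exact_mod_cast (by simpa using this)
  · exact ⟨le_rfl, by push_cast; exact mul_pos (by exact_mod_cast one_le_bigSide hMh _) (by norm_num)⟩

/-- … and has level `k − 1`. [cite: Balaban1984PropagatorsII, (2.1) p.224] -/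
theorem threeTopT_lev_x1 (d ℓ k' Mh : ℕ) (hMh : 1 ≤ Mh) :
    (threeTopT d ℓ k' Mh hMh).D.lev (fun μ : Fin (d + 1) => if μ = 0 then ((bigSide ℓ Mh (k' + 3) : ℕ) : ℤ) else 0)
      = k' + 2 := by
  show threeLevT (d := d) ℓ k' Mh _ = k' + 2
  have hB1 : 1 ≤ bigSide ℓ Mh (k' + 3) := one_le_bigSide hMh _
  have hb1 : 1 ≤ bigSide ℓ Mh (k' + 2) := one_le_bigSide hMh _
  have hBne : ((bigSide ℓ Mh (k' + 3) : ℕ) : ℤ) ≠ 0 := by exact_mod_cast (by omega : bigSide ℓ Mh (k' + 3) ≠ 0)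
  have hbne : ((bigSide ℓ Mh (k' + 2) : ℕ) : ℤ) ≠ 0 := by exact_mod_cast (by omega : bigSide ℓ Mh (k' + 2) ≠ 0)
  have hB : ((bigSide ℓ Mh (k' + 3) : ℕ) : ℤ) = ((ℓ : ℤ) + 1) * bigSide ℓ Mh (k' + 2) := by
    rw [B6MultiLevelBoxOperator.bigSide_succ]; push_cast; ring
  unfold threeLevT
  have htop : blk (bigSide ℓ Mh (k' + 3)) (fun μ : Fin (d + 1) => if μ = 0 then ((bigSide ℓ Mh (k' + 3) : ℕ) : ℤ) else 0)
      ≠ 0 := by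
    intro h
    have h0 := congrFun h 0
    simp only [blk, if_true, Pi.zero_apply] at h0
    rw [Int.ediv_self hBne] at h0
    exact one_ne_zero h0
  rw [if_neg htop, if_pos]
  intro ν
  left
  simp only [blk]
  split_ifs
  · rw [hB, Int.mul_ediv_cancel _ hbne]
    have : (0 : ℤ) ≤ ℓ := Nat.cast_nonneg ℓ
    linarith
  · rw [Int.zero_ediv]; positivity

/-- the site `3L·bigSide(k−1)·e₀` lies in the torus … [cite: Balaban1984PropagatorsII, (2.1) p.224] -/
theorem threeTopT_x2_mem (d ℓ k' Mh : ℕ) (hMh : 1 ≤ Mh) :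
    (fun μ : Fin (d + 1) => if μ = 0 then 3 * ((ℓ : ℤ) + 1) * ((bigSide ℓ Mh (k' + 2) : ℕ) : ℤ) else 0)
      ∈ (threeTopT d ℓ k' Mh hMh).XB := by
  rw [mem_boxDom]; intro μ
  rw [threeTopT_NB]
  have hb1 : 1 ≤ bigSide ℓ Mh (k' + 2) := one_le_bigSide hMh _
  have hB : ((bigSide ℓ Mh (k' + 3) : ℕ) : ℤ) = ((ℓ : ℤ) + 1) * bigSide ℓ Mh (k' + 2) := by
    rw [B6MultiLevelBoxOperator.bigSide_succ]; push_cast; ring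
  split_ifs
  · refine ⟨by positivity, ?_⟩
    push_cast
    rw [hB]
    have hb0 : (0 : ℤ) < bigSide ℓ Mh (k' + 2) := by exact_mod_cast hb1
    have hL0 : (0 : ℤ) < (ℓ : ℤ) + 1 := by positivity
    nlinarith [mul_pos hL0 hb0]
  · exact ⟨le_rfl, by push_cast; exact mul_pos (by exact_mod_cast one_le_bigSide hMh _) (by norm_num)⟩

/-- … and has level `k − 2`. [cite: Balaban1984PropagatorsII, (2.1) p.224] -/
theorem threeTopT_lev_x2 (d ℓ k' Mh : ℕ) (hMh : 1 ≤ Mh) :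
    (threeTopT d ℓ k' Mh hMh).D.lev
        (fun μ : Fin (d + 1) => if μ = 0 then 3 * ((ℓ : ℤ) + 1) * ((bigSide ℓ Mh (k' + 2) : ℕ) : ℤ) else 0) = k' + 1 := by
  show threeLevT (d := d) ℓ k' Mh _ = k' + 1
  have hb1 : 1 ≤ bigSide ℓ Mh (k' + 2) := one_le_bigSide hMh _
  have hbne : ((bigSide ℓ Mh (k' + 2) : ℕ) : ℤ) ≠ 0 := by exact_mod_cast (by omega : bigSide ℓ Mh (k' + 2) ≠ 0)
  have hLne : ((ℓ : ℤ) + 1) ≠ 0 := by positivity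
  have hB : ((bigSide ℓ Mh (k' + 3) : ℕ) : ℤ) = ((ℓ : ℤ) + 1) * bigSide ℓ Mh (k' + 2) := by
    rw [B6MultiLevelBoxOperator.bigSide_succ]; push_cast; ring
  unfold threeLevT
  have hq3 : 3 * ((ℓ : ℤ) + 1) * ((bigSide ℓ Mh (k' + 2) : ℕ) : ℤ) / ((bigSide ℓ Mh (k' + 3) : ℕ) : ℤ) = 3 := by
    rw [hB, show 3 * ((ℓ : ℤ) + 1) * ((bigSide ℓ Mh (k' + 2) : ℕ) : ℤ)
      = 3 * (((ℓ : ℤ) + 1) * ((bigSide ℓ Mh (k' + 2) : ℕ) : ℤ)) by ring]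
    exact Int.mul_ediv_cancel _ (mul_ne_zero hLne hbne)
  have hqb : 3 * ((ℓ : ℤ) + 1) * ((bigSide ℓ Mh (k' + 2) : ℕ) : ℤ) / ((bigSide ℓ Mh (k' + 2) : ℕ) : ℤ)
      = 3 * ((ℓ : ℤ) + 1) := Int.mul_ediv_cancel _ hbne
  have htop : blk (bigSide ℓ Mh (k' + 3))
      (fun μ : Fin (d + 1) => if μ = 0 then 3 * ((ℓ : ℤ) + 1) * ((bigSide ℓ Mh (k' + 2) : ℕ) : ℤ) else 0) ≠ 0 := by
    intro h
    have h0 := congrFun h 0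
    simp only [blk, if_true, Pi.zero_apply] at h0
    rw [hq3] at h0
    norm_num at h0
  have hmid : ¬ ∀ ν, blk (bigSide ℓ Mh (k' + 2))
      (fun μ : Fin (d + 1) => if μ = 0 then 3 * ((ℓ : ℤ) + 1) * ((bigSide ℓ Mh (k' + 2) : ℕ) : ℤ) else 0) ν
        < 3 * ((ℓ : ℤ) + 1) ∨ 4 * ((ℓ : ℤ) + 1) ≤ blk (bigSide ℓ Mh (k' + 2))
      (fun μ : Fin (d + 1) => if μ = 0 then 3 * ((ℓ : ℤ) + 1) * ((bigSide ℓ Mh (k' + 2) : ℕ) : ℤ) else 0) ν := by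
    intro h
    have h0 := h 0
    simp only [blk, if_true] at h0
    rw [hqb] at h0
    have hL0 : (0 : ℤ) < (ℓ : ℤ) + 1 := by positivity
    rcases h0 with h0 | h0
    · exact lt_irrefl _ h0
    · linarith
  rw [if_neg htop, if_neg hmid]

end KTIdx

open KTIdx in
/-- **NON-VACUITY WITH THE TORUS (2.2) ACTIVE**: for every `k ≥ 3` and every threshold `M₁` there is a member of the torus family
with `M ≥ M₁` whose geometry has blocks at the THREE levels `k`, `k − 1`, `k − 2` (`KTIdx.threeTopT`: `Ω_k` = one big `k`-block,
`Ω_{k−1}` = a two-sided collar of big `(k−1)`-blocks around it at torus distance `> R·M·L^{k−1}` from `Ω_{k−1}^c`, `R = 2L`) — so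
the separation (2.2) WITH THE TORUS DISTANCE constrains this member non-trivially and `prop22_supEntries_kLevelTorus` is a statement
about genuinely multi-level torus geometries beyond every threshold. [cite: Balaban1984PropagatorsII, (2.1)–(2.2) p.224, Prop. 2.2 p.234] -/
theorem kLevelTorus_nonvacuous3 (d ℓ k : ℕ) (hk : 3 ≤ k) (M₁ : ℝ) :
    ∃ i : KTIdx d ℓ, i.k = k ∧ M₁ ≤ i.geoT.M ∧ i.geoT.Hyp21_22 ∧
      (∃ s : i.geoT.Site, i.geoT.scale s = k) ∧ (∃ s : i.geoT.Site, i.geoT.scale s = k - 1) ∧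
        (∃ s : i.geoT.Site, i.geoT.scale s = k - 2) := by
  set Mh : ℕ := max 1 ⌈M₁⌉₊ with hMh_def
  have hMh : 1 ≤ Mh := le_max_left _ _
  obtain ⟨k', rfl⟩ : ∃ k', k = k' + 3 := ⟨k - 3, by omega⟩
  refine ⟨threeTopT d ℓ k' Mh hMh, rfl, ?_, trivial, ?_, ?_, ?_⟩
  · change M₁ ≤ ((ℓ : ℝ) + 1) * ((threeTopT d ℓ k' Mh hMh).Mh : ℝ)
    have h1 : M₁ ≤ (Mh : ℝ) := le_trans (Nat.le_ceil M₁) (by exact_mod_cast le_max_right 1 ⌈M₁⌉₊)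
    have h2 : (Mh : ℝ) ≤ ((ℓ : ℝ) + 1) * Mh := by
      have : (0 : ℝ) ≤ Mh := Nat.cast_nonneg Mh
      nlinarith [(Nat.cast_nonneg ℓ : (0 : ℝ) ≤ ℓ)]
    exact h1.trans (by exact_mod_cast h2)
  · refine ⟨blkOf (threeTopT d ℓ k' Mh hMh).D.toDomains (threeTopT d ℓ k' Mh hMh).origin, ?_⟩
    rw [geoT_scale, ← lev_eq_of_blkOf_eq (D := (threeTopT d ℓ k' Mh hMh).D.toDomains) rfl]
    exact threeTopT_lev_zero d ℓ k' Mh hMh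
  · refine ⟨blkOf (threeTopT d ℓ k' Mh hMh).D.toDomains ⟨_, threeTopT_x1_mem d ℓ k' Mh hMh⟩, ?_⟩
    rw [geoT_scale, ← lev_eq_of_blkOf_eq (D := (threeTopT d ℓ k' Mh hMh).D.toDomains) rfl]
    rw [TDomains.toDomains_lev, threeTopT_lev_x1 d ℓ k' Mh hMh]; rfl
  · refine ⟨blkOf (threeTopT d ℓ k' Mh hMh).D.toDomains ⟨_, threeTopT_x2_mem d ℓ k' Mh hMh⟩, ?_⟩
    rw [geoT_scale, ← lev_eq_of_blkOf_eq (D := (threeTopT d ℓ k' Mh hMh).D.toDomains) rfl]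
    rw [TDomains.toDomains_lev, threeTopT_lev_x2 d ℓ k' Mh hMh]
    omega

end Literature.MathematicalPhysics.QuantumFieldTheory.Balaban1983to89.B6Prop22KLevelTorusCensus

end
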